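import Literature.MathematicalPhysics.QuantumLattice.PeriodicStatesCellAverage
import Literature.Computation.Certificates.BoxCoveringByCells
import HarnessLib

/-!
# The superlattice variational calculus: cell energies of a family of VIEWS over periodic states, their
# variational densities, the coupling-family calculus (concavity, box ⇒ word, Lipschitz, tangent caps), and
# «periodic order cannot lower the energy of a translation-invariant model»

Topic `Literature/MathematicalPhysics/QuantumLattice` (family `hubbard`; general dimension `d`). Sequel of
`PeriodicStatesCellAverage` (`IsPeriodic`, `Cell`, `cellAverage`: the cell average of a periodic state is
translation invariant) and the superlattice twin of `TIGroundEnergyDensityCouplingFamilies` (whose proofs it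
mirrors line by line with the cell energy in place of the mean energy). Written for stage S2
(CERTIFIER-FAMILIES, «families of models», D-0096 (ii): multi-band, ladders, staggered fields) of the Hubbard
material-oracle programme. A SUPERLATTICE model — a decorated lattice (three-band-by-decoration), a
trellis/ladder array (router boxes #32/#38), a staggered potential or pinning field, or simply a
translation-invariant model studied over states with an enlarged unit cell — is not translation covariant, so
the translation-invariant variational densities of the tree do not apply to it. Its natural variational class
is the `q`-PERIODIC states, and its energy per site in such a state is the CELL ENERGY
`e_M(ω) = |C|⁻¹ Σ_{n∈C} e_{M n}(ω ∘ τ_{pos n})` of the family of its VIEWS `M n` (the model as seen with the cell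
point `n` at the origin — for a translation-invariant model all views coincide; for a decorated model the views
are the decoration pattern re-centred, to be supplied by the atoms of a sequel). This file is the model-free
calculus of that functional.

* §1 `InfVolFermionState.cellEnergy M R ω`, `cellFilling q ω` (= density of the cell average); for constant views
  `e_{(Ψ)}(ω) = e_Ψ(cellAverage ω)`, and for translation-invariant `ω` simply `e_Ψ(ω)` / `ρ(ω)`; the a-priori bound
  `|e_M(ω)| ≤ |C|⁻¹ Σ_n ‖E_{M n}‖`; LINEAR FAMILIES OF VIEWS `viewFamily M₀ D θ n = M₀ n + Σ_a θ_a D_a n` with the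
  affine formula `e_{M(θ)}(ω) = e_{M₀}(ω) + Σ_a θ_a e_{D_a}(ω)` (cell-averaged conjugate densities as slopes).
* §2 `infCellEnergyOn S M R = inf_{ω∈S} e_M(ω)` with `periodicStates q`, `periodicStatesAt q ρ`; bounded below,
  `inf ≤ e_M(ω)`, greatest-lower-bound form, minimisers attain.
* §3 CONSISTENCY: **`infCellEnergyOn (periodicStates q) (Ψ) R = tiGroundEnergyDensity Ψ R`** and
  **`infCellEnergyOn (periodicStatesAt q ρ) (Ψ) R = tiGroundEnergyDensityAt Ψ R ρ`** for every interaction `Ψ`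
  (constant views), every `q`, every `ρ`: enlarging the variational class from translation-invariant to
  superlattice-periodic states (any periods) changes neither `e₀` nor `e_ρ` — superlattice order at fixed mean
  filling cannot go below, and loses nothing against, the translation-invariant infimum.
* §4 THE CALCULUS over any class `S` (in particular the periodic classes): JOINT CONCAVITY of
  `θ ↦ inf_S e_{M(θ)}` (`concaveOn_infCellEnergyOn_viewFamily`), BOX ⇒ WORD from the `2^|ι|` vertices
  (`le_infCellEnergyOn_viewFamily_of_mem_Icc`), JOINT LIPSCHITZ with class constants on the cell-averaged
  conjugate densities (`abs_infCellEnergyOn_viewFamily_sub_le`), the transported TRIAL-STATE CAP and the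
  TANGENT PLANE at a class minimiser (`…_le_trial`, `…_le_tangent`).

* §5 (appended) ONE ANCHOR COVERS THE BOX over a superlattice class: minimiser transport priced by class-wide
  brackets on the cell-averaged conjugate densities (`cellEnergy_anchor_le_excess_of_isMinOn`), energy-window
  words at one anchor ⇒ every class minimiser in the coupling box (`of_cellEnergyWindow_word_of_isMinOn[_of_abs_sub_le]`),
  and two-sided brackets on every cell-averaged conjugate density from three anchor-line numbers
  (`cellEnergy_mem_Icc_of_anchor_data`) — the superlattice twins of `TIGroundEnergyDensityCouplingFamilies` §11.

Everything is PROVED; definitions with bodies (`cellEnergy`, `cellFilling`, `viewFamily`, `infCellEnergyOn`,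
`periodicStates`, `periodicStatesAt`), no named fact, no number of record, no `sorry`. HONEST SCOPE: energy
words only; the decorated-lattice ATOMS (sublattice-selective hopping / on-site terms whose views are the
re-centred decoration) are not in this file; the identification of the cell energy with the thermodynamic limit
of `ω(H_Λ)/|Λ|` for periodic states and covariant superlattice models is the periodic twin of Bratteli–Robinson
II §6.2.4 and is not restated; nothing bears on order / pairing words.

## Mathlib / tree search

REUSED: `IsPeriodic`, `Cell`, `cellPos`, `cellAverage`, `shiftAverage`, `IsPeriodic.isTranslationInvariant_cellAverage`,
`meanEnergy_cellAverage`, `density_cellAverage`, `IsTranslationInvariant.shiftAverage_eq/isPeriodic` (`PeriodicStatesCellAverage`);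
`FermionInteraction.linearFamily`, `InfVolFermionState.meanEnergy_linearFamily`, `tiGroundEnergyDensityAt_le_meanEnergy`,
`tiGroundEnergyDensityAt_eq_infMeanEnergyOn`, `infMeanEnergyOn_empty` (`TIGroundEnergyDensityCouplingFamilies`);
`tiGroundEnergyDensity_le_meanEnergy`, `abs_meanEnergy_le_norm` (`TIGroundEnergyDensityResponse`); `vacuumState(_isTranslationInvariant)`;
`BoxCovering.exists_convexWeights_boxVertices` (`Computation/Certificates/BoxCoveringByCells`); Mathlib `ConcaveOn.le_map_sum`,
`csInf_le`, `le_csInf`, `Real.sInf_empty`. `lean search 'cellEnergy|infCellEnergy|periodicStates|viewFamily' --decl`: nothing.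

## References

* R. B. Israel, *Convexity in the Theory of Lattice Gases* (1979), Thm. I.3.4. [cite: Israel1979, Thm. I.3.4]
* O. Bratteli, A. Kishimoto, D. W. Robinson, CMP 64 (1978) 41, §3, Thm. 2. [cite: BratteliKishimotoRobinson1978, Thm. 2 (condition 2)]
* O. Bratteli, D. W. Robinson, *OAQSM 1* (1987), §4.3.1, Prop. 2.3.11. [cite: BratteliRobinsonI1987, §4.3.1]
* R. B. Griffiths, J. Math. Phys. 5 (1964) 1215 / Koma–Tasaki (1994) §1 (tangent functionals, conjugate
  densities). [cite: KomaTasaki1994, §1]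
* R. T. Rockafellar, *Convex Analysis* (1970), Thm. 32.2. [cite: Rockafellar1970, Thm 32.2]
* H. Araki, H. Moriya, Rev. Math. Phys. 15 (2003) 93, §4.1. [cite: ArakiMoriya2003, §4.1 Def. 4.5]
-/

noncomputable section

namespace Literature.MathematicalPhysics.QuantumLattice

open Matrix Finset HubbardWave0 Literature.Probability.LatticeModels ThermodynamicLimit
open Literature.Computation.Certificates
open scoped ComplexOrder BigOperators

/-! ### §1. The cell energy of a family of views, and the cell filling -/

section CellEnergy

variable {d : ℕ} {q : Fin d → ℕ}

/-- **The cell-averaged energy density of a state for a superlattice model given by its VIEWS**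
`M : Cell q → FermionInteraction d` (`M n` = the model as seen with the cell point `n` at the origin; for a
translation-invariant model all views coincide): `e_M(ω) := |C|⁻¹ Σ_{n∈C} e_{M n}(ω ∘ τ_{pos n})`. For a
`q`-periodic `ω` this is the energy per site of the superlattice state. [cite: BratteliKishimotoRobinson1978, §3 (mean energy functional)] -/
def InfVolFermionState.cellEnergy (M : Cell q → FermionInteraction d) (R : ℝ) (ω : InfVolFermionState d) : ℝ :=
  (Fintype.card (Cell q) : ℝ)⁻¹ * ∑ n : Cell q, (ω.shift (cellPos n)).meanEnergy (M n) R

/-- **The cell filling** `ρ̄(ω) := |C|⁻¹ Σ_{n∈C} ρ(ω ∘ τ_{pos n})` (= the density of the cell average).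
[cite: ArakiMoriya2003, §4.1] -/
def InfVolFermionState.cellFilling (q : Fin d → ℕ) (ω : InfVolFermionState d) : ℝ :=
  (Fintype.card (Cell q) : ℝ)⁻¹ * ∑ n : Cell q, (ω.shift (cellPos n)).density

/-- The cell filling is the density of the cell average. [cite: ArakiMoriya2003, §4.1] -/
theorem InfVolFermionState.cellFilling_eq_density_cellAverage (ω : InfVolFermionState d) :
    ω.cellFilling q = (ω.cellAverage q).density :=
  (ω.density_cellAverage).symm

/-- **For a translation-invariant MODEL (constant views) the cell energy is the mean energy of the cell
average.** [cite: BratteliKishimotoRobinson1978, §3 (mean energy functional)] -/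
theorem InfVolFermionState.cellEnergy_const (Ψ : FermionInteraction d) (R : ℝ) (ω : InfVolFermionState d) :
    ω.cellEnergy (fun _ : Cell q => Ψ) R = (ω.cellAverage q).meanEnergy Ψ R :=
  (ω.meanEnergy_cellAverage Ψ R).symm

/-- For a translation-invariant STATE the cell energy of constant views is the ordinary mean energy, and the
cell filling is the density. [cite: BratteliKishimotoRobinson1978, §3 (mean energy functional)] -/
theorem InfVolFermionState.IsTranslationInvariant.cellEnergy_const {ω : InfVolFermionState d}
    (hω : ω.IsTranslationInvariant) (Ψ : FermionInteraction d) (R : ℝ) :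
    ω.cellEnergy (fun _ : Cell q => Ψ) R = ω.meanEnergy Ψ R := by
  rw [ω.cellEnergy_const, InfVolFermionState.cellAverage, hω.shiftAverage_eq]

/-- The cell filling of a translation-invariant state is its density. [cite: ArakiMoriya2003, §4.1] -/
theorem InfVolFermionState.IsTranslationInvariant.cellFilling_eq {ω : InfVolFermionState d}
    (hω : ω.IsTranslationInvariant) : ω.cellFilling q = ω.density := by
  rw [ω.cellFilling_eq_density_cellAverage, InfVolFermionState.cellAverage, hω.shiftAverage_eq]

open scoped Matrix.Norms.L2Operator in
/-- **A priori bound**: `|e_M(ω)| ≤ |C|⁻¹ Σ_n ‖E_{M n}‖` for every state. [cite: BratteliRobinsonI1987, Prop. 2.3.11] -/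
theorem InfVolFermionState.abs_cellEnergy_le (M : Cell q → FermionInteraction d) (R : ℝ) (ω : InfVolFermionState d) :
    |ω.cellEnergy M R| ≤ (Fintype.card (Cell q) : ℝ)⁻¹ * ∑ n : Cell q, ‖(M n).meanEnergyObs R‖ := by
  rw [InfVolFermionState.cellEnergy, abs_mul, abs_of_nonneg (inv_nonneg.2 (Nat.cast_nonneg _))]
  exact mul_le_mul_of_nonneg_left ((Finset.abs_sum_le_sum_abs _ _).trans
    (Finset.sum_le_sum fun n _ => (ω.shift (cellPos n)).abs_meanEnergy_le_norm (M n) R)) (inv_nonneg.2 (Nat.cast_nonneg _))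

/-- **Linear families of views**: `M(θ) n = M₀ n + Σ_a θ_a D_a n` (every view moves affinely with the couplings;
e.g. the amplitude of one decorated bond class). [cite: KomaTasaki1994, §1] -/
def viewFamily {ι : Type*} [Fintype ι] (M₀ : Cell q → FermionInteraction d) (D : ι → Cell q → FermionInteraction d)
    (θ : ι → ℝ) : Cell q → FermionInteraction d :=
  fun n => FermionInteraction.linearFamily (M₀ n) (fun a => D a n) θ

/-- **The cell energy is affine in the couplings**: `e_{M(θ)}(ω) = e_{M₀}(ω) + Σ_a θ_a e_{D_a}(ω)` — the slopes
`e_{D_a}(ω)` are the CELL-AVERAGED conjugate densities. [cite: KomaTasaki1994, §1] -/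
theorem InfVolFermionState.cellEnergy_viewFamily {ι : Type*} [Fintype ι] (M₀ : Cell q → FermionInteraction d)
    (D : ι → Cell q → FermionInteraction d) (θ : ι → ℝ) (R : ℝ) (ω : InfVolFermionState d) :
    ω.cellEnergy (viewFamily M₀ D θ) R = ω.cellEnergy M₀ R + ∑ a, θ a * ω.cellEnergy (D a) R := by
  simp only [InfVolFermionState.cellEnergy, viewFamily, InfVolFermionState.meanEnergy_linearFamily,
    Finset.sum_add_distrib, mul_add, Finset.mul_sum]
  rw [Finset.sum_comm]
  refine congrArg _ (Finset.sum_congr rfl fun a _ => Finset.sum_congr rfl fun n _ => by ring)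

/-- Moving the couplings: `e_{M(θ)}(ω) = e_{M(θ')}(ω) + Σ_a (θ_a − θ'_a) e_{D_a}(ω)`. [cite: KomaTasaki1994, §1] -/
theorem InfVolFermionState.cellEnergy_viewFamily_eq_add_sum_sub_mul {ι : Type*} [Fintype ι]
    (M₀ : Cell q → FermionInteraction d) (D : ι → Cell q → FermionInteraction d) (θ θ' : ι → ℝ) (R : ℝ)
    (ω : InfVolFermionState d) :
    ω.cellEnergy (viewFamily M₀ D θ) R = ω.cellEnergy (viewFamily M₀ D θ') R + ∑ a, (θ a - θ' a) * ω.cellEnergy (D a) R := by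
  rw [ω.cellEnergy_viewFamily, ω.cellEnergy_viewFamily, add_assoc, ← Finset.sum_add_distrib]
  exact congrArg _ (Finset.sum_congr rfl fun a _ => by ring)

end CellEnergy

/-! ### §2. The variational cell energy over a class of states -/

section Variational

variable {d : ℕ} {q : Fin d → ℕ}

/-- **The variational cell energy of the model `M` over a class `S`**: `inf {e_M(ω) : ω ∈ S}` (real `sInf`;
`0` on an empty class). The classes of interest: the `q`-periodic states (`periodicStates q`) and the
`q`-periodic states of cell filling `ρ` (`periodicStatesAt q ρ`). [cite: BratteliKishimotoRobinson1978, Thm. 2 (condition 2)] -/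
def infCellEnergyOn (S : Set (InfVolFermionState d)) (M : Cell q → FermionInteraction d) (R : ℝ) : ℝ :=
  sInf ((fun ω : InfVolFermionState d => ω.cellEnergy M R) '' S)

/-- The `q`-periodic states. [cite: ArakiMoriya2003, §4.1 Def. 4.5] -/
def periodicStates (q : Fin d → ℕ) : Set (InfVolFermionState d) := {ω | ω.IsPeriodic q}

/-- The `q`-periodic states of cell filling `ρ`. [cite: ArakiMoriya2003, §4.1 Def. 4.5] -/
def periodicStatesAt (q : Fin d → ℕ) (ρ : ℝ) : Set (InfVolFermionState d) := {ω | ω.IsPeriodic q ∧ ω.cellFilling q = ρ}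

variable (S : Set (InfVolFermionState d)) (M : Cell q → FermionInteraction d) (R : ℝ)

/-- The empty class gives `0`. [cite: BratteliKishimotoRobinson1978, Thm. 2 (condition 2)] -/
theorem infCellEnergyOn_empty : infCellEnergyOn ∅ M R = 0 := by
  rw [infCellEnergyOn, Set.image_empty, Real.sInf_empty]

open scoped Matrix.Norms.L2Operator in
/-- The cell energies over any class are bounded below. [cite: BratteliRobinsonI1987, Prop. 2.3.11] -/
theorem bddBelow_cellEnergy_image : BddBelow ((fun ω : InfVolFermionState d => ω.cellEnergy M R) '' S) := by
  refine ⟨-((Fintype.card (Cell q) : ℝ)⁻¹ * ∑ n : Cell q, ‖(M n).meanEnergyObs R‖), ?_⟩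
  rintro _ ⟨ω, -, rfl⟩
  exact (abs_le.1 (ω.abs_cellEnergy_le M R)).1

variable {S}

/-- **Variational upper bound**: `inf_S e_M ≤ e_M(ω)` for `ω ∈ S`. [cite: BratteliKishimotoRobinson1978, Thm. 2 (condition 2)] -/
theorem infCellEnergyOn_le_cellEnergy {ω : InfVolFermionState d} (hω : ω ∈ S) :
    infCellEnergyOn S M R ≤ ω.cellEnergy M R :=
  csInf_le (bddBelow_cellEnergy_image S M R) (Set.mem_image_of_mem _ hω)

/-- **Greatest lower bound** (non-empty class). [cite: BratteliKishimotoRobinson1978, Thm. 2 (condition 2)] -/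
theorem le_infCellEnergyOn (hS : S.Nonempty) {c : ℝ} (h : ∀ ω ∈ S, c ≤ ω.cellEnergy M R) :
    c ≤ infCellEnergyOn S M R :=
  le_csInf (hS.image _) (by rintro _ ⟨ω, hω, rfl⟩; exact h ω hω)

/-- A class minimiser attains the infimum. [cite: BratteliKishimotoRobinson1978, Thm. 2 (condition 2)] -/
theorem cellEnergy_eq_infCellEnergyOn_of_isMinOn {ω : InfVolFermionState d} (hω : ω ∈ S)
    (hmin : IsMinOn (fun σ : InfVolFermionState d => σ.cellEnergy M R) S ω) :
    ω.cellEnergy M R = infCellEnergyOn S M R :=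
  le_antisymm (le_infCellEnergyOn M R ⟨ω, hω⟩ fun _ hσ => hmin hσ) (infCellEnergyOn_le_cellEnergy M R hω)

end Variational

/-! ### §3. Enlarging the class to periodic states changes nothing for translation-invariant models -/

section Consistency

variable {d : ℕ} (q : Fin d → ℕ) (Ψ : FermionInteraction d) (R : ℝ)

/-- **PERIODIC ORDER CANNOT LOWER THE ENERGY OF A TRANSLATION-INVARIANT MODEL**: over the `q`-periodic
states (any periods) the variational cell energy of constant views `Ψ` equals the translation-invariant
variational density `e₀(Ψ)`. (`≥`: the cell average of a periodic state competes in the translation-invariant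
class; `≤`: translation-invariant states are periodic.) [cite: BratteliKishimotoRobinson1978, Thm. 2 (condition 2)] -/
theorem infCellEnergyOn_periodic_const_eq_tiGroundEnergyDensity :
    infCellEnergyOn (periodicStates q) (fun _ : Cell q => Ψ) R = Ψ.tiGroundEnergyDensity R := by
  refine le_antisymm ?_ ?_
  · -- `≤`: compare with every translation-invariant state
    refine le_csInf ⟨_, ⟨vacuumState d, InfVolFermionState.vacuumState_isTranslationInvariant, rfl⟩⟩ ?_
    rintro _ ⟨ω, hω, rfl⟩
    have h := infCellEnergyOn_le_cellEnergy (fun _ : Cell q => Ψ) R (S := periodicStates q)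
      (show ω ∈ periodicStates q from InfVolFermionState.IsTranslationInvariant.isPeriodic hω q)
    rwa [InfVolFermionState.IsTranslationInvariant.cellEnergy_const hω] at h
  · -- `≥`: the cell average of a periodic state is translation invariant
    refine le_infCellEnergyOn _ R ⟨vacuumState d,
      show vacuumState d ∈ periodicStates q from
        InfVolFermionState.vacuumState_isTranslationInvariant.isPeriodic q⟩ fun ω hω => ?_
    rw [ω.cellEnergy_const]
    exact Ψ.tiGroundEnergyDensity_le_meanEnergy R (InfVolFermionState.IsPeriodic.isTranslationInvariant_cellAverage hω)

/-- **The same at fixed filling**: over the `q`-periodic states of cell filling `ρ`, the variational cell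
energy of a translation-invariant model is the canonical density `e_ρ(Ψ)` — superlattice order at fixed mean
filling cannot go below the translation-invariant fixed-filling infimum, and loses nothing either.
[cite: BratteliKishimotoRobinson1978, Thm. 2 (condition 2)] -/
theorem infCellEnergyOn_periodicAt_const_eq_tiGroundEnergyDensityAt (ρ : ℝ) :
    infCellEnergyOn (periodicStatesAt q ρ) (fun _ : Cell q => Ψ) R = Ψ.tiGroundEnergyDensityAt R ρ := by
  rcases ({ω : InfVolFermionState d | ω.IsTranslationInvariant ∧ ω.density = ρ}).eq_empty_or_nonempty with h | hne
  · -- no translation-invariant state of density `ρ` ⇒ no periodic state of cell filling `ρ` either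
    have h' : periodicStatesAt q ρ = ∅ := by
      refine Set.eq_empty_iff_forall_notMem.2 fun ω hω => ?_
      have : ω.cellAverage q ∈ {ω : InfVolFermionState d | ω.IsTranslationInvariant ∧ ω.density = ρ} :=
        ⟨InfVolFermionState.IsPeriodic.isTranslationInvariant_cellAverage hω.1,
          by rw [← ω.cellFilling_eq_density_cellAverage, hω.2]⟩
      rw [h] at this
      exact this
    rw [h', infCellEnergyOn_empty, FermionInteraction.tiGroundEnergyDensityAt_eq_infMeanEnergyOn, h,
      FermionInteraction.infMeanEnergyOn_empty]
  refine le_antisymm ?_ ?_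
  · obtain ⟨ω₀, hω₀⟩ := hne
    refine le_csInf ⟨_, ⟨ω₀, hω₀, rfl⟩⟩ ?_
    rintro _ ⟨ω, ⟨hω, hρ⟩, rfl⟩
    have h := infCellEnergyOn_le_cellEnergy (fun _ : Cell q => Ψ) R (S := periodicStatesAt q ρ)
      (show ω ∈ periodicStatesAt q ρ from ⟨hω.isPeriodic q, by rw [hω.cellFilling_eq, hρ]⟩)
    rwa [InfVolFermionState.IsTranslationInvariant.cellEnergy_const hω] at h
  · obtain ⟨ω₀, hω₀, hρ₀⟩ := hne
    refine le_infCellEnergyOn _ R ⟨ω₀, show ω₀ ∈ periodicStatesAt q ρ from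
      ⟨hω₀.isPeriodic q, by rw [hω₀.cellFilling_eq, hρ₀]⟩⟩ fun ω hω => ?_
    rw [ω.cellEnergy_const]
    exact Ψ.tiGroundEnergyDensityAt_le_meanEnergy R (InfVolFermionState.IsPeriodic.isTranslationInvariant_cellAverage hω.1)
      (by rw [← ω.cellFilling_eq_density_cellAverage, hω.2])

end Consistency

/-! ### §4. The coupling-family calculus over superlattice classes -/

section Calculus

variable {d : ℕ} {q : Fin d → ℕ} {ι : Type*} [Fintype ι] (S : Set (InfVolFermionState d))
  (M₀ : Cell q → FermionInteraction d) (D : ι → Cell q → FermionInteraction d) (R : ℝ)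

/-- **JOINT CONCAVITY in the couplings** of the variational cell energy over ANY class (an infimum of the
affine functions `θ ↦ e_{M(θ)}(ω)`). [cite: Israel1979, Thm. I.3.4] -/
theorem concaveOn_infCellEnergyOn_viewFamily :
    ConcaveOn ℝ Set.univ fun θ : ι → ℝ => infCellEnergyOn S (viewFamily M₀ D θ) R := by
  refine ⟨convex_univ, fun x _ y _ a b ha hb hab => ?_⟩
  rcases S.eq_empty_or_nonempty with rfl | hS
  · simp only [infCellEnergyOn_empty, smul_zero, add_zero, le_refl]
  refine le_infCellEnergyOn _ R hS fun ω hω => ?_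
  have hx := infCellEnergyOn_le_cellEnergy (viewFamily M₀ D x) R hω
  have hy := infCellEnergyOn_le_cellEnergy (viewFamily M₀ D y) R hω
  rw [ω.cellEnergy_viewFamily] at hx hy ⊢
  simp only [smul_eq_mul, Pi.add_apply, Pi.smul_apply]
  have hsum : ∑ c, (a * x c + b * y c) * ω.cellEnergy (D c) R =
      a * ∑ c, x c * ω.cellEnergy (D c) R + b * ∑ c, y c * ω.cellEnergy (D c) R := by
    rw [Finset.mul_sum, Finset.mul_sum, ← Finset.sum_add_distrib]
    exact Finset.sum_congr rfl fun c _ => by ring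
  have key : ω.cellEnergy M₀ R + ∑ c, (a * x c + b * y c) * ω.cellEnergy (D c) R =
      a * (ω.cellEnergy M₀ R + ∑ c, x c * ω.cellEnergy (D c) R) +
        b * (ω.cellEnergy M₀ R + ∑ c, y c * ω.cellEnergy (D c) R) := by
    rw [hsum]; linear_combination (-ω.cellEnergy M₀ R) * hab
  rw [key]
  exact add_le_add (mul_le_mul_of_nonneg_left hx ha) (mul_le_mul_of_nonneg_left hy hb)

/-- **BOX ⇒ WORD**: a floor certified at the `2^|ι|` vertices of a coupling box holds at every coupling vector
of the box. [cite: Rockafellar1970, Thm 32.2] -/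
theorem le_infCellEnergyOn_viewFamily_of_mem_Icc [DecidableEq ι] (lo hi : ι → ℝ) {m : ℝ}
    (hm : ∀ v ∈ Fintype.piFinset (fun a => ({lo a, hi a} : Finset ℝ)), m ≤ infCellEnergyOn S (viewFamily M₀ D v) R)
    {θ : ι → ℝ} (hθ : θ ∈ Set.Icc lo hi) : m ≤ infCellEnergyOn S (viewFamily M₀ D θ) R := by
  obtain ⟨w, hw0, hw1, hsum⟩ := BoxCovering.exists_convexWeights_boxVertices lo hi hθ
  have hJ := (concaveOn_infCellEnergyOn_viewFamily S M₀ D R).le_map_sum hw0 hw1 (fun v _ => Set.mem_univ v)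
  rw [hsum] at hJ
  refine le_trans ?_ hJ
  calc m = ∑ v ∈ Fintype.piFinset (fun a => ({lo a, hi a} : Finset ℝ)), w v * m := by rw [← Finset.sum_mul, hw1, one_mul]
    _ ≤ _ := Finset.sum_le_sum fun v hv => by
        rw [smul_eq_mul]; exact mul_le_mul_of_nonneg_left (hm v hv) (hw0 v hv)

/-- **JOINT LIPSCHITZ BOUND with class constants**: if the cell-averaged conjugate densities are bracketed on
the class, `|e_{D_a}(ω)| ≤ C_a` for `ω ∈ S` (non-empty), then `|e_S(θ) − e_S(θ')| ≤ Σ_a C_a|θ_a − θ'_a|`.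
[cite: Israel1979, Thm. I.3.4] -/
theorem abs_infCellEnergyOn_viewFamily_sub_le {S} (hS : S.Nonempty) {C : ι → ℝ}
    (hC : ∀ ω ∈ S, ∀ a, |ω.cellEnergy (D a) R| ≤ C a) (θ θ' : ι → ℝ) :
    |infCellEnergyOn S (viewFamily M₀ D θ) R - infCellEnergyOn S (viewFamily M₀ D θ') R| ≤ ∑ a, C a * |θ a - θ' a| := by
  -- one-sided step, used twice
  have step : ∀ θ θ' : ι → ℝ, infCellEnergyOn S (viewFamily M₀ D θ) R ≤
      infCellEnergyOn S (viewFamily M₀ D θ') R + ∑ a, C a * |θ a - θ' a| := by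
    intro θ θ'
    rw [← sub_le_iff_le_add]
    refine le_infCellEnergyOn _ R hS fun ω hω => ?_
    rw [sub_le_iff_le_add]
    have h1 := infCellEnergyOn_le_cellEnergy (viewFamily M₀ D θ) R hω
    rw [ω.cellEnergy_viewFamily_eq_add_sum_sub_mul M₀ D θ θ' R] at h1
    have h3 : ∑ a, (θ a - θ' a) * ω.cellEnergy (D a) R ≤ ∑ a, C a * |θ a - θ' a| :=
      Finset.sum_le_sum fun a _ => by
        calc (θ a - θ' a) * ω.cellEnergy (D a) R ≤ |(θ a - θ' a) * ω.cellEnergy (D a) R| := le_abs_self _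
          _ = |θ a - θ' a| * |ω.cellEnergy (D a) R| := abs_mul _ _
          _ ≤ |θ a - θ' a| * C a := mul_le_mul_of_nonneg_left (hC ω hω a) (abs_nonneg _)
          _ = C a * |θ a - θ' a| := mul_comm _ _
    linarith
  rw [abs_sub_le_iff]
  constructor
  · linarith [step θ θ']
  · have h := step θ' θ
    have hs : ∑ a, C a * |θ' a - θ a| = ∑ a, C a * |θ a - θ' a| :=
      Finset.sum_congr rfl fun a _ => by rw [abs_sub_comm]
    linarith

/-- **TRIAL-STATE CAP, transported**: for ANY `ω₀ ∈ S`, `e_S(θ) ≤ e_{M(θ₀)}(ω₀) + Σ_a (θ_a − θ₀_a) e_{D_a}(ω₀)`.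
[cite: KomaTasaki1994, §1] -/
theorem infCellEnergyOn_viewFamily_le_trial {S} {ω₀ : InfVolFermionState d} (hω₀ : ω₀ ∈ S) (θ₀ θ : ι → ℝ) :
    infCellEnergyOn S (viewFamily M₀ D θ) R ≤
      ω₀.cellEnergy (viewFamily M₀ D θ₀) R + ∑ a, (θ a - θ₀ a) * ω₀.cellEnergy (D a) R := by
  rw [← ω₀.cellEnergy_viewFamily_eq_add_sum_sub_mul M₀ D θ θ₀ R]
  exact infCellEnergyOn_le_cellEnergy _ R hω₀

/-- **TANGENT PLANE at a class minimiser**: if `ω₀ ∈ S` minimises `e_{M(θ₀)}` on `S`, then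
`e_S(θ) ≤ e_S(θ₀) + Σ_a (θ_a − θ₀_a) e_{D_a}(ω₀)` — the cell-averaged conjugate densities of a minimiser form a
supergradient. [cite: Griffiths1966, §II] -/
theorem infCellEnergyOn_viewFamily_le_tangent {S} {ω₀ : InfVolFermionState d} (hω₀ : ω₀ ∈ S) {θ₀ : ι → ℝ}
    (hmin : IsMinOn (fun σ : InfVolFermionState d => σ.cellEnergy (viewFamily M₀ D θ₀) R) S ω₀) (θ : ι → ℝ) :
    infCellEnergyOn S (viewFamily M₀ D θ) R ≤
      infCellEnergyOn S (viewFamily M₀ D θ₀) R + ∑ a, (θ a - θ₀ a) * ω₀.cellEnergy (D a) R := by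
  rw [← cellEnergy_eq_infCellEnergyOn_of_isMinOn _ R hω₀ hmin]
  exact infCellEnergyOn_viewFamily_le_trial M₀ D R hω₀ θ₀ θ

end Calculus


/-! ### §5. One anchor covers the box over a superlattice class: minimiser transport and energy-window words -/

section AnchorWords

variable {d : ℕ} {q : Fin d → ℕ} {ι : Type*} [Fintype ι] {S : Set (InfVolFermionState d)}
  (M₀ : Cell q → FermionInteraction d) (D : ι → Cell q → FermionInteraction d) (R : ℝ)

/-- If `inf_S e_M < c` (non-empty class) some `ω ∈ S` has `e_M(ω) < c`. [cite: BratteliKishimotoRobinson1978, Thm. 2 (condition 2)] -/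
theorem exists_cellEnergy_lt_of_infCellEnergyOn_lt (M : Cell q → FermionInteraction d) (hS : S.Nonempty) {c : ℝ}
    (h : infCellEnergyOn S M R < c) : ∃ ω ∈ S, ω.cellEnergy M R < c := by
  obtain ⟨_, ⟨ω, hω, rfl⟩, hlt⟩ := exists_lt_of_csInf_lt (hS.image _) h
  exact ⟨ω, hω, hlt⟩

/-- `|x − y| ≤ hi − lo` for `x, y ∈ [lo, hi]`. [folklore] -/
private theorem abs_sub_le_of_mem_Icc' {x y lo hi : ℝ} (hx : x ∈ Set.Icc lo hi) (hy : y ∈ Set.Icc lo hi) :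
    |x - y| ≤ hi - lo := by
  rw [abs_sub_le_iff]
  constructor <;> linarith [hx.1, hx.2, hy.1, hy.2]

/-- **Minimiser transport, priced, with no minimiser needed at the anchor**: if `ω ∈ S` minimises `e_{M(θ)}` on `S`
and the cell-averaged conjugate densities are bracketed class-wide, `e_{D_a}(σ) ∈ [lo_a, hi_a]` for `σ ∈ S`, then
`e_{M(θ₀)}(ω) ≤ e_S(θ₀) + Σ_a |θ_a − θ₀_a|(hi_a − lo_a)`. [cite: WangEtAl2024, §III] -/
theorem cellEnergy_anchor_le_excess_of_isMinOn {ω : InfVolFermionState d} (hω : ω ∈ S) {θ : ι → ℝ}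
    (hmin : IsMinOn (fun σ : InfVolFermionState d => σ.cellEnergy (viewFamily M₀ D θ) R) S ω)
    {lo hi : ι → ℝ} (hB : ∀ σ ∈ S, ∀ a, σ.cellEnergy (D a) R ∈ Set.Icc (lo a) (hi a)) (θ₀ : ι → ℝ) :
    ω.cellEnergy (viewFamily M₀ D θ₀) R ≤ infCellEnergyOn S (viewFamily M₀ D θ₀) R + ∑ a, |θ a - θ₀ a| * (hi a - lo a) := by
  refine le_of_forall_pos_le_add fun η hη => ?_
  obtain ⟨σ, hσ, hlt⟩ := exists_cellEnergy_lt_of_infCellEnergyOn_lt R (viewFamily M₀ D θ₀) ⟨ω, hω⟩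
    (lt_add_of_pos_right (infCellEnergyOn S (viewFamily M₀ D θ₀) R) hη)
  have h1 : ω.cellEnergy (viewFamily M₀ D θ) R ≤ σ.cellEnergy (viewFamily M₀ D θ) R := hmin hσ
  rw [ω.cellEnergy_viewFamily_eq_add_sum_sub_mul M₀ D θ θ₀ R, σ.cellEnergy_viewFamily_eq_add_sum_sub_mul M₀ D θ θ₀ R] at h1
  have h2 : ∑ a, (θ a - θ₀ a) * σ.cellEnergy (D a) R - ∑ a, (θ a - θ₀ a) * ω.cellEnergy (D a) R ≤
      ∑ a, |θ a - θ₀ a| * (hi a - lo a) := by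
    rw [← Finset.sum_sub_distrib]
    exact Finset.sum_le_sum fun a _ => by
      calc (θ a - θ₀ a) * σ.cellEnergy (D a) R - (θ a - θ₀ a) * ω.cellEnergy (D a) R
          = (θ a - θ₀ a) * (σ.cellEnergy (D a) R - ω.cellEnergy (D a) R) := by ring
        _ ≤ |(θ a - θ₀ a) * (σ.cellEnergy (D a) R - ω.cellEnergy (D a) R)| := le_abs_self _
        _ = |θ a - θ₀ a| * |σ.cellEnergy (D a) R - ω.cellEnergy (D a) R| := abs_mul _ _
        _ ≤ |θ a - θ₀ a| * (hi a - lo a) :=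
            mul_le_mul_of_nonneg_left (abs_sub_le_of_mem_Icc' (hB σ hσ a) (hB ω hω a)) (abs_nonneg _)
  linarith

/-- **AN ENERGY-WINDOW WORD AT ONE ANCHOR COVERS THE COUPLING BOX** (superlattice classes): a word `P` certified
at the anchor `θ₀` for every state of `S` inside the cell-energy window of slack `ε` holds for every `S`-minimiser
of `M(θ)` whenever `Σ_a |θ_a − θ₀_a|(hi_a − lo_a) ≤ ε`. [cite: WangEtAl2024, §III] -/
theorem of_cellEnergyWindow_word_of_isMinOn {P : InfVolFermionState d → Prop} {θ₀ : ι → ℝ} {ε : ℝ}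
    (hword : ∀ σ ∈ S, σ.cellEnergy (viewFamily M₀ D θ₀) R ≤ infCellEnergyOn S (viewFamily M₀ D θ₀) R + ε → P σ)
    {lo hi : ι → ℝ} (hB : ∀ σ ∈ S, ∀ a, σ.cellEnergy (D a) R ∈ Set.Icc (lo a) (hi a))
    {θ : ι → ℝ} (hθ : ∑ a, |θ a - θ₀ a| * (hi a - lo a) ≤ ε) {ω : InfVolFermionState d} (hω : ω ∈ S)
    (hmin : IsMinOn (fun σ : InfVolFermionState d => σ.cellEnergy (viewFamily M₀ D θ) R) S ω) : P ω :=
  hword ω hω ((cellEnergy_anchor_le_excess_of_isMinOn M₀ D R hω hmin hB θ₀).trans (by linarith))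

/-- **Box form**: radii `r_a` with `Σ_a r_a(hi_a − lo_a) ≤ ε` ⇒ the anchor word holds for every `S`-minimiser at
every `θ` with `|θ_a − θ₀_a| ≤ r_a`. [cite: WangEtAl2024, §III] -/
theorem of_cellEnergyWindow_word_of_isMinOn_of_abs_sub_le {P : InfVolFermionState d → Prop} {θ₀ : ι → ℝ} {ε : ℝ}
    (hword : ∀ σ ∈ S, σ.cellEnergy (viewFamily M₀ D θ₀) R ≤ infCellEnergyOn S (viewFamily M₀ D θ₀) R + ε → P σ)
    {lo hi : ι → ℝ} (hB : ∀ σ ∈ S, ∀ a, σ.cellEnergy (D a) R ∈ Set.Icc (lo a) (hi a))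
    {r : ι → ℝ} (hr : ∑ a, r a * (hi a - lo a) ≤ ε) {θ : ι → ℝ} (hθ : ∀ a, |θ a - θ₀ a| ≤ r a)
    {ω : InfVolFermionState d} (hω : ω ∈ S)
    (hmin : IsMinOn (fun σ : InfVolFermionState d => σ.cellEnergy (viewFamily M₀ D θ) R) S ω) : P ω := by
  refine of_cellEnergyWindow_word_of_isMinOn M₀ D R hword hB (le_trans ?_ hr) hω hmin
  exact Finset.sum_le_sum fun a _ =>
    mul_le_mul_of_nonneg_right (hθ a) (by linarith [(hB ω hω a).1, (hB ω hω a).2])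

/-- **Certified two-sided brackets on every cell-averaged conjugate density from anchor-line data**: floors
`f₊ ≤ e_S(θ₀ + δe_a)`, `f₋ ≤ e_S(θ₀ − δe_a)` (`δ > 0`) and a cap `e_{M(θ₀)}(ω) ≤ u` on a state `ω ∈ S` give
`(f₋ − u)/δ ≤ … ` — precisely `(u − f₋)/δ ≥ −e_{D_a}(ω)` and `e_{D_a}(ω) ≥ (f₊ − u)/δ`:
`e_{D_a}(ω) ∈ [(f₊ − u)/δ, (u − f₋)/δ]`. [cite: KomaTasaki1994, §1] -/
theorem cellEnergy_mem_Icc_of_anchor_data [DecidableEq ι] {ω : InfVolFermionState d} (hω : ω ∈ S) (θ₀ : ι → ℝ) (a : ι)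
    {δ u fplus fminus : ℝ} (hδ : 0 < δ) (hu : ω.cellEnergy (viewFamily M₀ D θ₀) R ≤ u)
    (hplus : fplus ≤ infCellEnergyOn S (viewFamily M₀ D (θ₀ + Pi.single a δ)) R)
    (hminus : fminus ≤ infCellEnergyOn S (viewFamily M₀ D (θ₀ - Pi.single a δ)) R) :
    ω.cellEnergy (D a) R ∈ Set.Icc ((fplus - u) / δ) ((u - fminus) / δ) := by
  have hstep : ∀ s : ℝ, ω.cellEnergy (viewFamily M₀ D (θ₀ + Pi.single a s)) R =
      ω.cellEnergy (viewFamily M₀ D θ₀) R + s * ω.cellEnergy (D a) R := by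
    intro s
    rw [ω.cellEnergy_viewFamily_eq_add_sum_sub_mul M₀ D _ θ₀ R]
    congr 1
    rw [Finset.sum_eq_single a]
    · rw [Pi.add_apply, Pi.single_eq_same, add_sub_cancel_left]
    · intro b _ hb
      rw [Pi.add_apply, Pi.single_eq_of_ne hb, add_zero, sub_self, zero_mul]
    · intro ha; exact absurd (Finset.mem_univ a) ha
  have h1 := hplus.trans (infCellEnergyOn_le_cellEnergy _ R hω)
  have h2 := hminus.trans (infCellEnergyOn_le_cellEnergy _ R hω)
  rw [hstep δ] at h1
  rw [sub_eq_add_neg, ← Pi.single_neg, hstep (-δ)] at h2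
  constructor
  · rw [div_le_iff₀ hδ]; linarith
  · rw [le_div_iff₀ hδ]; linarith

end AnchorWords

end Literature.MathematicalPhysics.QuantumLattice

end
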